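import Summits.QuantumFields.YangMills.Theorems.BalabanUVNodesK1V10Defs
import Literature.MathematicalPhysics.QuantumFieldTheory.Balaban1983to89.Node00.CarriersB8SubBP2DPerKappa

/-! DEF-1 g10 — BY-NAME REVIEW of the P2′ DOORS (c₁)∕(c₂) (dag-n05-w1 g4 LANDED-2 p642573 `Node00/CarriersB8SubBP2DPer.lean`: `upOfRecord₅CS_pinB8SubBP₂DPer_b8_iff` ∕
`upOfRecord₅CS_b8_iff_of_res_X_eq_subBP₂DPer`) and of the κ-DOORS (c₁κ)∕(c₂κ) (their (K2) `Node00/CarriersB8SubBP2DPerKappa.lean`: `upOfRecord₅CS_pinB8SubBP₂DPerκ_b8_iff` ∕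
`upOfRecord₅CS_b8_iff_of_res_X_eq_subBP₂DPerκ`) AGAINST THE REGISTERED RUNG BYTES as read by `K1V9Defs.RecordSV` (p628520; `K1V10Defs` p634834 keeps `RecordSV` for LINE 2′):
at an `RecordSⱽ` world the S-binding clause is `∀ P, w.up P = Node00.upOfRecord₅CS F 2 (θ'.toStage5₁₃CoPH F 2) P` for the PRESENTING tuple `θ'`, and `(θ'.toStage5₁₃CoPH F 2).res.X` IS
`θ'.res.X` (free residual data, `rfl`), so a presenting tuple whose residual [B8] group on run `R` is the periodic δ₂-substitution (resp. its print-class κ-cut at `(M₁, R₁)`) meets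
`B8LeafOfRecordSubBP₂DPer` (resp. `B8LeafOfRecordSubBP₂DPerκ`) through door (c₂) (resp. (c₂κ)) — `rw [hup]` + the door BY NAME; no Stage-13 pin, no rung re-key (plan g86 DIFF = ∅ reading).
Pattern = this seat's g9 `DEF1DoorCReview.lean` (PENS-217 (c)).  Scratch; not filed; count-neutral. -/

noncomputable section

open scoped Matrix.Norms.L2Operator

namespace Summit.QuantumFields.YangMills.Cruxes.DEF1DoorC2KappaReview

open Literature.MathematicalPhysics.QuantumFieldTheory.Balaban1983to89
open Literature.MathematicalPhysics.QuantumFieldTheory.Balaban1983to89.T4Continuum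
open Literature.MathematicalPhysics.QuantumFieldTheory.Balaban1983to89.DagBinding
open Summit.QuantumFields.YangMills.Theorems.K1V9Defs

/-- the Stage-13 view's residual `X` group IS the tuple's (free data), `rfl` -/
example {F : T4Family} (θ' : Node00.Stage13HParams F 2) (R : B12.RunParams) : (θ'.toStage5₁₃CoPH F 2).res.X R = θ'.res.X R := rfl

/-- DOOR (c₁) elaborates at the Stage-13 view's Stage-5 parameters, δ₂-periodically pinned (`Iff.rfl` by name). -/
example {F : T4Family} (θ' : Node00.Stage13HParams F 2) (P : ℕ) (lam : Node00.ResidB8Per (θ'.toStage5₁₃CoPH F 2).toStage3Params P) (R : B12.RunParams) :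
    (Node00.upOfRecord₅CS F 2 ((θ'.toStage5₁₃CoPH F 2).pinB8SubBP₂DPer F 2 P lam) R).b8 ↔ Node00.B8LeafOfRecordSubBP₂DPer (θ'.toStage5₁₃CoPH F 2).toStage3Params P lam :=
  Node00.upOfRecord₅CS_pinB8SubBP₂DPer_b8_iff F 2 (θ'.toStage5₁₃CoPH F 2) P lam R

/-- DOOR (c₁κ) elaborates at the Stage-13 view's Stage-5 parameters, κ-pinned at `(P, M₁, R₁)` (`Iff.rfl` by name). -/
example {F : T4Family} (θ' : Node00.Stage13HParams F 2) (P M₁ R₁ : ℕ) (lam : Node00.ResidB8Per (θ'.toStage5₁₃CoPH F 2).toStage3Params P) (R : B12.RunParams) :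
    (Node00.upOfRecord₅CS F 2 ((θ'.toStage5₁₃CoPH F 2).pinB8SubBP₂DPerκ F 2 P M₁ R₁ lam) R).b8 ↔
      Node00.B8LeafOfRecordSubBP₂DPerκ (θ'.toStage5₁₃CoPH F 2).toStage3Params P M₁ R₁ lam :=
  Node00.upOfRecord₅CS_pinB8SubBP₂DPerκ_b8_iff F 2 (θ'.toStage5₁₃CoPH F 2) lam R

/-- DOOR (c₂) read at an `RecordSⱽ` world's S-binding clause: the world's [B8] leaf on run `R` IS `B8LeafOfRecordSubBP₂DPer` for a presenting tuple with the periodic δ₂-substitution there. -/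
theorem world_b8_iff_b8LeafOfRecordSubBP₂DPer {F : T4Family} (θ' : Node00.Stage13HParams F 2) (w : WorldP) (R : B12.RunParams)
    (hup : w.up R = Node00.upOfRecord₅CS F 2 (θ'.toStage5₁₃CoPH F 2) R)
    (X₀ : PrintedCarriersR) (P : ℕ) (lam : Node00.ResidB8Per (θ'.toStage5₁₃CoPH F 2).toStage3Params P)
    (hX : θ'.res.X R = X₀.withB8OfRecordSubBP₂DPer (θ'.toStage5₁₃CoPH F 2).toStage3Params P lam) :
    (w.up R).b8 ↔ Node00.B8LeafOfRecordSubBP₂DPer (θ'.toStage5₁₃CoPH F 2).toStage3Params P lam := by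
  rw [hup]
  exact Node00.upOfRecord₅CS_b8_iff_of_res_X_eq_subBP₂DPer F 2 (θ'.toStage5₁₃CoPH F 2) R X₀ P lam hX

/-- DOOR (c₂κ) read at an `RecordSⱽ` world's S-binding clause: the world's [B8] leaf on run `R` IS `B8LeafOfRecordSubBP₂DPerκ … P M₁ R₁ lam` for a presenting tuple with the κ-cut substitution there. -/
theorem world_b8_iff_b8LeafOfRecordSubBP₂DPerκ {F : T4Family} (θ' : Node00.Stage13HParams F 2) (w : WorldP) (R : B12.RunParams)
    (hup : w.up R = Node00.upOfRecord₅CS F 2 (θ'.toStage5₁₃CoPH F 2) R)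
    (X₀ : PrintedCarriersR) (P M₁ R₁ : ℕ) (lam : Node00.ResidB8Per (θ'.toStage5₁₃CoPH F 2).toStage3Params P)
    (hX : θ'.res.X R = X₀.withB8OfRecordSubBP₂DPerκ (θ'.toStage5₁₃CoPH F 2).toStage3Params P M₁ R₁ lam) :
    (w.up R).b8 ↔ Node00.B8LeafOfRecordSubBP₂DPerκ (θ'.toStage5₁₃CoPH F 2).toStage3Params P M₁ R₁ lam := by
  rw [hup]
  exact Node00.upOfRecord₅CS_b8_iff_of_res_X_eq_subBP₂DPerκ F 2 (θ'.toStage5₁₃CoPH F 2) R X₀ lam hX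

/-- UNCUT ⇒ CUT at the world: with the (uncut) periodic δ₂-substitution on run `R`, the world's `b8` leaf gives the κ-leaf at every `(M₁, R₁)` (P2′ door + K2's `…κ_of_subBP₂DPer`). -/
theorem world_b8LeafOfRecordSubBP₂DPerκ_of_b8 {F : T4Family} (θ' : Node00.Stage13HParams F 2) (w : WorldP) (R : B12.RunParams)
    (hup : w.up R = Node00.upOfRecord₅CS F 2 (θ'.toStage5₁₃CoPH F 2) R)
    (X₀ : PrintedCarriersR) (P M₁ R₁ : ℕ) (lam : Node00.ResidB8Per (θ'.toStage5₁₃CoPH F 2).toStage3Params P)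
    (hX : θ'.res.X R = X₀.withB8OfRecordSubBP₂DPer (θ'.toStage5₁₃CoPH F 2).toStage3Params P lam) (hb8 : (w.up R).b8) :
    Node00.B8LeafOfRecordSubBP₂DPerκ (θ'.toStage5₁₃CoPH F 2).toStage3Params P M₁ R₁ lam :=
  Node00.b8LeafOfRecordSubBP₂DPerκ_of_subBP₂DPer lam ((world_b8_iff_b8LeafOfRecordSubBP₂DPer θ' w R hup X₀ P lam hX).1 hb8)

/-- … and from `RecordSV F θ h v w` itself: the presenting tuple `θ'` with its S-binding clause, read off the def (nothing else of the class used). -/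
theorem exists_presenting_up_of_recordSV {F : T4Family} {θ : Node00.Stage13HParams F 2} {h : θ.Provisos₁₃SepCoPH F 2} {v : Node00.Revision₁₃ F 2 θ h} {w : WorldP}
    (hR : RecordSV F θ h v w) :
    ∃ (θ' : Node00.Stage13HParams F 2) (_h' : θ'.Provisos₁₃SepCoPH F 2), θ'.Admissible F 2 ∧
      Node00.datumOfRecord₁₃SepCoPH F 2 θ h = Node00.datumOfRecord₁₃SepCoPH F 2 θ' _h' ∧ ∀ P : B12.RunParams, w.up P = Node00.upOfRecord₅CS F 2 (θ'.toStage5₁₃CoPH F 2) P := by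
  obtain ⟨θ', h', hθ', hD, -, -, -, hup⟩ := hR
  exact ⟨θ', h', hθ', hD, hup⟩

/-- THE REVIEWED STATEMENT (c₂): at an `RecordSⱽ` world whose presenting tuple carries the periodic δ₂ [B8] substitution on run `R`, the world's `b8` leaf ↔ `B8LeafOfRecordSubBP₂DPer …`. -/
theorem recordSV_b8_iff_b8LeafOfRecordSubBP₂DPer {F : T4Family} {θ : Node00.Stage13HParams F 2} {h : θ.Provisos₁₃SepCoPH F 2} {v : Node00.Revision₁₃ F 2 θ h} {w : WorldP}
    (θ' : Node00.Stage13HParams F 2) (h' : θ'.Provisos₁₃SepCoPH F 2) (hθ' : θ'.Admissible F 2)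
    (hD : Node00.datumOfRecord₁₃SepCoPH F 2 θ h = Node00.datumOfRecord₁₃SepCoPH F 2 θ' h') (hC : w.C = (Node00.datumOfRecord₁₃SepCoPHV F 2 θ h v).C)
    (hγ : 0 < w.γ ∧ w.γ ≤ θ'.γ) (hL : w.L = (θ'.L : ℝ)) (hup : ∀ P : B12.RunParams, w.up P = Node00.upOfRecord₅CS F 2 (θ'.toStage5₁₃CoPH F 2) P)
    (R : B12.RunParams) (X₀ : PrintedCarriersR) (P : ℕ) (lam : Node00.ResidB8Per (θ'.toStage5₁₃CoPH F 2).toStage3Params P)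
    (hX : θ'.res.X R = X₀.withB8OfRecordSubBP₂DPer (θ'.toStage5₁₃CoPH F 2).toStage3Params P lam) :
    RecordSV F θ h v w ∧ ((w.up R).b8 ↔ Node00.B8LeafOfRecordSubBP₂DPer (θ'.toStage5₁₃CoPH F 2).toStage3Params P lam) :=
  ⟨⟨θ', h', hθ', hD, hC, hγ, hL, hup⟩, world_b8_iff_b8LeafOfRecordSubBP₂DPer θ' w R (hup R) X₀ P lam hX⟩

/-- THE REVIEWED STATEMENT (c₂κ): at an `RecordSⱽ` world whose presenting tuple carries the κ-cut periodic δ₂ [B8] substitution on run `R` at `(P, M₁, R₁)`, the world's `b8` leaf ↔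
`B8LeafOfRecordSubBP₂DPerκ … P M₁ R₁ lam` — the print-class (1.3)–(1.4) display reached from the registered `RecordSV` bytes with NO Stage-13 pin and NO rung re-key. -/
theorem recordSV_b8_iff_b8LeafOfRecordSubBP₂DPerκ {F : T4Family} {θ : Node00.Stage13HParams F 2} {h : θ.Provisos₁₃SepCoPH F 2} {v : Node00.Revision₁₃ F 2 θ h} {w : WorldP}
    (θ' : Node00.Stage13HParams F 2) (h' : θ'.Provisos₁₃SepCoPH F 2) (hθ' : θ'.Admissible F 2)
    (hD : Node00.datumOfRecord₁₃SepCoPH F 2 θ h = Node00.datumOfRecord₁₃SepCoPH F 2 θ' h') (hC : w.C = (Node00.datumOfRecord₁₃SepCoPHV F 2 θ h v).C)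
    (hγ : 0 < w.γ ∧ w.γ ≤ θ'.γ) (hL : w.L = (θ'.L : ℝ)) (hup : ∀ P : B12.RunParams, w.up P = Node00.upOfRecord₅CS F 2 (θ'.toStage5₁₃CoPH F 2) P)
    (R : B12.RunParams) (X₀ : PrintedCarriersR) (P M₁ R₁ : ℕ) (lam : Node00.ResidB8Per (θ'.toStage5₁₃CoPH F 2).toStage3Params P)
    (hX : θ'.res.X R = X₀.withB8OfRecordSubBP₂DPerκ (θ'.toStage5₁₃CoPH F 2).toStage3Params P M₁ R₁ lam) :
    RecordSV F θ h v w ∧ ((w.up R).b8 ↔ Node00.B8LeafOfRecordSubBP₂DPerκ (θ'.toStage5₁₃CoPH F 2).toStage3Params P M₁ R₁ lam) :=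
  ⟨⟨θ', h', hθ', hD, hC, hγ, hL, hup⟩, world_b8_iff_b8LeafOfRecordSubBP₂DPerκ θ' w R (hup R) X₀ P M₁ R₁ lam hX⟩

end Summit.QuantumFields.YangMills.Cruxes.DEF1DoorC2KappaReview

end
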